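import Literature.NumberTheory.Transcendental.NesterenkoNormForm
import Literature.NumberTheory.Transcendental.NesterenkoUResultantIntegral
import Literature.NumberTheory.Transcendental.NesterenkoUResultantChow
import Mathlib.RingTheory.Valuation.ExtendToLocalization
import HarnessLib

/-!
# The norm form of the generic section is a polynomial of degree `s · deg 𝔭 · deg Q`

`Literature/NumberTheory/Transcendental/NesterenkoNormFormPolynomial.lean`. For `𝒢 : GSec m`
(a homogeneous prime `𝔭 ⊂ ℚ[x₀, …, x_m]` of rank `s + 1` with chart `x_j ∉ 𝔭`), `A = ℚ[U']`
(`s` groups of `m + 1` variables), `K' = ℚ(U')`, `𝕃₀ = K'(ρ)` the field of the generic section point,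
`D = deg 𝔭 = [𝕃₀ : K']`, and a form `Q ∈ ℚ[x̲]` of degree `q`, the NORM FORM
`G_Q = a^q · N_{𝕃₀/K'}(Q(ρ)) ∈ K'` (`GSec.normForm`, `NesterenkoNormForm.lean`) is

* **a polynomial** (`exists_normForm_poly`): `G_Q = N` for some `N ∈ A` — in `Ω ⊇ 𝕃`,
  `G_Q = a^q ∏_σ Q(β_σ)` over the `D` conjugates of `ρ`, and `a ∏_σ (β_σ · w)` is the associated
  form `F(u₁, …, u_s; w)` whose coefficients lie in `A`; by Gauss's lemma in every valuation ring
  of `Ω` containing `A` (`splitNorm_mem_valuationSubring`) and `A` integrally closed;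
* **of total degree `≤ s · D · q`** (`totalDegree_normFormPoly_le`): the same argument in every
  valuation ring of `Ω` containing the "degree" valuation ring of `K'` (`v(P) = exp(deg P)`,
  `degValuation`), after rescaling `F(u; w)` by `u₀₀^{−sD}` (its coefficients have degree `sD`).

This is the degree statement `deg_u Res(F, R) ≤ deg R · deg_{u₁…u_s} F` used in Nesterenko's
bound for the Hilbert function ([Nes3]; Zhu, App. 3, (19)); in the tree the `u`-resultant on the
`Ω_U`-side (`uResultant`, `blockDeg_uResultant`) carries the same information, here it is proved
directly for the `GSec` norm form, which is the object the counting argument differentiates.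

## References

* [NesterenkoPhilippon2001] LNM 1752, Ch. 3 Prop. 4.11 (pp. 40–41); Ch. 10 Lemma 3.1 (p. 153).
* [Nes3] Yu. V. Nesterenko, Mat. Sb. 123 (1984), proof of Thm 1 ((15), (19)).
-/

noncomputable section

open MvPolynomial

attribute [local instance] MvPolynomial.gradedAlgebra

namespace Literature.NumberTheory.Transcendental

namespace Nesterenko

variable {m : ℕ}

/-! ### Descent from all valuation rings of a big field -/

/-- **Valuative descent.** Let `B ⊆ K'` be an integrally closed domain with field of fractions
`K'`, `K' ⊆ Ω` a field. If `z ∈ K'` lies in every valuation subring of `Ω` containing (the image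
of) `B`, then `z ∈ B`: `z` is then integral over `B` (Stacks 090P), hence in `B`. [folklore] -/
theorem mem_range_of_forall_valuationSubring {B K Ω : Type*} [CommRing B] [IsDomain B] [Field K]
    [Field Ω] [Algebra B K] [IsFractionRing B K] [Algebra K Ω] [Algebra B Ω] [IsScalarTower B K Ω]
    [IsIntegrallyClosed B] (z : K)
    (h : ∀ V : ValuationSubring Ω, (∀ b : B, algebraMap B Ω b ∈ V) → algebraMap K Ω z ∈ V) :
    z ∈ (algebraMap B K).range := by
  have hz : algebraMap K Ω z ∈ (integralClosure B Ω).toSubring := by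
    rw [Subring.eq_iInf_of_isIntegrallyClosedIn (R := (integralClosure B Ω).toSubring),
      Subring.mem_iInf]
    rintro ⟨V, hV⟩
    exact h V fun b => hV (by
      change algebraMap B Ω b ∈ (integralClosure B Ω).toSubring
      exact isIntegral_algebraMap)
  have hint : IsIntegral B (algebraMap K Ω z) := hz
  have hint' : IsIntegral B z :=
    (isIntegral_algHom_iff (IsScalarTower.toAlgHom B K Ω) (algebraMap K Ω).injective).mp hint
  obtain ⟨b, hb⟩ := IsIntegrallyClosed.isIntegral_iff.mp hint'
  exact ⟨b, hb⟩

/-! ### The degree valuation of a polynomial ring and its field of fractions -/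

section DegVal

variable {σ K : Type*} [Field K]

open scoped Classical in
/-- **The degree "valuation"** `v(P) = exp(deg P)` (`v(0) = 0`) on `K[σ]`: multiplicative over a
domain and `deg(P + Q) ≤ max`, i.e. a valuation in Mathlib's sense (its ring of integers in the
field of fractions is `{P/Q : deg P ≤ deg Q}`, the local ring "at infinity" of the total degree).
[folklore] -/
def degValuation : Valuation (MvPolynomial σ K) (WithZero (Multiplicative ℤ)) where
  toFun p := if p = 0 then 0 else ((Multiplicative.ofAdd (p.totalDegree : ℤ) : Multiplicative ℤ) :
    WithZero (Multiplicative ℤ))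
  map_zero' := by simp
  map_one' := by simp
  map_mul' p q := by
    by_cases hp : p = 0
    · rw [if_pos hp, hp, zero_mul, if_pos rfl, zero_mul]
    by_cases hq : q = 0
    · rw [if_pos hq, hq, mul_zero, if_pos rfl, mul_zero]
    rw [if_neg (mul_ne_zero hp hq), if_neg hp, if_neg hq, totalDegree_mul_of_isDomain hp hq,
      ← WithZero.coe_mul, ← ofAdd_add]
    push_cast
    rfl
  map_add_le_max' p q := by
    by_cases hpq : p + q = 0
    · rw [if_pos hpq]; exact zero_le
    rw [if_neg hpq]
    by_cases hp : p = 0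
    · subst hp
      rw [zero_add] at hpq ⊢
      rw [if_neg hpq]
      exact le_max_right _ _
    by_cases hq : q = 0
    · subst hq
      rw [add_zero] at hpq ⊢
      rw [if_neg hpq]
      exact le_max_left _ _
    rw [if_neg hp, if_neg hq, le_max_iff, WithZero.coe_le_coe, WithZero.coe_le_coe,
      Multiplicative.ofAdd_le, Multiplicative.ofAdd_le]
    have := totalDegree_add p q
    rcases le_max_iff.mp this with h | h
    · left; exact_mod_cast h
    · right; exact_mod_cast h

/-- The degree valuation, unfolded. [folklore] -/
theorem degValuation_apply [DecidableEq (MvPolynomial σ K)] (p : MvPolynomial σ K) :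
    degValuation p = if p = 0 then 0 else ((Multiplicative.ofAdd (p.totalDegree : ℤ) :
      Multiplicative ℤ) : WithZero (Multiplicative ℤ)) := by
  unfold degValuation
  simp only [Valuation.coe_mk, MonoidWithZeroHom.coe_mk, ZeroHom.coe_mk]
  congr

/-- The degree valuation of a non-zero polynomial. [folklore] -/
theorem degValuation_apply_of_ne_zero {p : MvPolynomial σ K} (hp : p ≠ 0) :
    degValuation p = ((Multiplicative.ofAdd (p.totalDegree : ℤ) : Multiplicative ℤ) :
      WithZero (Multiplicative ℤ)) := by
  classical
  rw [degValuation_apply, if_neg hp]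

/-- The degree valuation vanishes only at `0`. [folklore] -/
theorem degValuation_eq_zero_iff {p : MvPolynomial σ K} : degValuation p = 0 ↔ p = 0 := by
  refine ⟨fun h => ?_, fun h => by subst h; exact (degValuation (σ := σ) (K := K)).map_zero⟩
  by_contra hp
  rw [degValuation_apply_of_ne_zero hp] at h
  exact WithZero.coe_ne_zero h

/-- Non-zero-divisors have non-zero degree valuation. [folklore] -/
theorem nonZeroDivisors_le_supp_primeCompl :
    nonZeroDivisors (MvPolynomial σ K) ≤ (degValuation (σ := σ) (K := K)).supp.primeCompl := by
  intro x hx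
  change x ∉ (degValuation (σ := σ) (K := K)).supp
  rw [Valuation.mem_supp_iff, degValuation_eq_zero_iff]
  exact nonZeroDivisors.ne_zero hx

variable (σ K)
variable (F : Type*) [Field F] [Algebra (MvPolynomial σ K) F] [IsFractionRing (MvPolynomial σ K) F]

/-- **The degree valuation on the field of rational functions.** [folklore] -/
def degValuationFrac : Valuation F (WithZero (Multiplicative ℤ)) :=
  (degValuation (σ := σ) (K := K)).extendToLocalization
    (S := nonZeroDivisors (MvPolynomial σ K)) nonZeroDivisors_le_supp_primeCompl F

variable {σ K F}

/-- The degree valuation of a polynomial inside the field of fractions. [folklore] -/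
@[simp] theorem degValuationFrac_algebraMap (p : MvPolynomial σ K) :
    degValuationFrac σ K F (algebraMap (MvPolynomial σ K) F p) = degValuation p :=
  Valuation.extendToLocalization_apply_map_apply _ _ _ p

/-- The ring of integers "at infinity": `{P/Q : deg P ≤ deg Q}`. [folklore] -/
def degSubring : ValuationSubring F := (degValuationFrac σ K F).valuationSubring

/-- Membership in the ring at infinity. [folklore] -/
theorem mem_degSubring_iff (x : F) :
    x ∈ degSubring (σ := σ) (K := K) (F := F) ↔ degValuationFrac σ K F x ≤ 1 := Iff.rfl

/-- Constants are integral at infinity. [folklore] -/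
theorem algebraMap_C_mem_degSubring (a : K) :
    algebraMap (MvPolynomial σ K) F (C a) ∈ degSubring (σ := σ) (K := K) (F := F) := by
  rw [mem_degSubring_iff, degValuationFrac_algebraMap]
  by_cases ha : (C a : MvPolynomial σ K) = 0
  · rw [ha, Valuation.map_zero]; exact zero_le
  · rw [degValuation_apply_of_ne_zero ha, totalDegree_C]; simp

/-- The value of a variable is `exp 1`. [folklore] -/
theorem degValuationFrac_X (i : σ) :
    degValuationFrac σ K F (algebraMap (MvPolynomial σ K) F (X i)) =
      ((Multiplicative.ofAdd (1 : ℤ) : Multiplicative ℤ) : WithZero (Multiplicative ℤ)) := by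
  rw [degValuationFrac_algebraMap, degValuation_apply_of_ne_zero (X_ne_zero i), totalDegree_X]
  rfl

/-- **`xᵢ^{−n} · P` is integral at infinity when `deg P ≤ n`.** [folklore] -/
theorem inv_pow_mul_mem_degSubring (i : σ) {n : ℕ} {p : MvPolynomial σ K} (hp : p.totalDegree ≤ n) :
    (algebraMap (MvPolynomial σ K) F (X i))⁻¹ ^ n * algebraMap (MvPolynomial σ K) F p ∈
      degSubring (σ := σ) (K := K) (F := F) := by
  rw [mem_degSubring_iff, Valuation.map_mul, Valuation.map_pow, Valuation.map_inv,
    degValuationFrac_X, degValuationFrac_algebraMap]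
  by_cases hp0 : p = 0
  · rw [hp0, Valuation.map_zero, mul_zero]; exact zero_le
  rw [degValuation_apply_of_ne_zero hp0, ← WithZero.coe_inv, ← WithZero.coe_pow, ← WithZero.coe_mul,
    ← WithZero.coe_one, WithZero.coe_le_coe, ← ofAdd_neg, ← ofAdd_nsmul, ← ofAdd_add, ← ofAdd_zero,
    Multiplicative.ofAdd_le]
  simp only [nsmul_eq_mul]
  omega

/-- **Conversely `xᵢ^{−n} · N` integral at infinity forces `deg N ≤ n`.** [folklore] -/
theorem totalDegree_le_of_mem_degSubring (i : σ) {n : ℕ} {N : MvPolynomial σ K}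
    (h : (algebraMap (MvPolynomial σ K) F (X i))⁻¹ ^ n * algebraMap (MvPolynomial σ K) F N ∈
      degSubring (σ := σ) (K := K) (F := F)) : N.totalDegree ≤ n := by
  by_cases hN : N = 0
  · rw [hN, totalDegree_zero]; exact Nat.zero_le _
  rw [mem_degSubring_iff, Valuation.map_mul, Valuation.map_pow, Valuation.map_inv,
    degValuationFrac_X, degValuationFrac_algebraMap, degValuation_apply_of_ne_zero hN,
    ← WithZero.coe_inv, ← WithZero.coe_pow, ← WithZero.coe_mul, ← WithZero.coe_one,
    WithZero.coe_le_coe, ← ofAdd_neg, ← ofAdd_nsmul, ← ofAdd_add, ← ofAdd_zero,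
    Multiplicative.ofAdd_le] at h
  simp only [nsmul_eq_mul] at h
  omega

end DegVal

/-! ### The coefficients of `F(u₁, …, u_s; w)` have degree `s · deg 𝔭` -/

/-- The "first part" monomial of an exponent `γ` has degree `∑_{i<s} deg_{uᵢ} γ`. [folklore] -/
theorem totalDegree_firstMono_le (s : ℕ) (γ : Fin (s + 1) × Fin (m + 1) →₀ ℕ) :
    (firstMono (m := m) s γ).totalDegree ≤ ∑ i : Fin s, bdeg (Fin.castSucc i) γ := by
  rw [firstMono]
  refine (totalDegree_finsetProd _ _).trans (Finset.sum_le_sum fun i _ => ?_)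
  refine (totalDegree_finsetProd _ _).trans ?_
  rw [bdeg]
  refine Finset.sum_le_sum fun k _ => (totalDegree_pow _ _).trans ?_
  rw [totalDegree_X, mul_one]

/-- `lastBlock` on a monomial. [folklore] -/
theorem lastBlock_monomial (s : ℕ) (γ : Fin (s + 1) × Fin (m + 1) →₀ ℕ) (a : ℚ) :
    lastBlock (m := m) s (monomial γ a) =
      C (C a * firstMono s γ) * ∏ k : Fin (m + 1), X k ^ γ (Fin.last s, k) := by
  rw [lastBlock, aeval_monomial, Finsupp.prod_pow, Fintype.prod_prod_type, Fin.prod_univ_castSucc]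
  simp only [Fin.lastCases_castSucc, Fin.lastCases_last]
  rw [firstMono, map_mul, map_prod, MvPolynomial.algebraMap_apply, MvPolynomial.algebraMap_eq,
    mul_assoc]
  congr 2
  refine Finset.prod_congr rfl fun i _ => ?_
  rw [map_prod]
  exact Finset.prod_congr rfl fun k _ => by rw [map_pow]

/-- **The coefficients of `F(u₁, …, u_s; w)` have total degree `≤ s · deg 𝔭`** (each monomial of
the associated form has degree `deg 𝔭` in every group). [cite: NesterenkoPhilippon2001, Ch. 3 §4, remark after Prop. 4.4 (p. 38)] -/
theorem totalDegree_coeff_lastBlock_chowForm_le (𝔭 : Ideal (Rx m)) (s : ℕ) (e : Fin (m + 1) →₀ ℕ) :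
    (coeff e (lastBlock s (chowForm 𝔭 (s + 1)))).totalDegree ≤ s * ideg 𝔭 (s + 1) := by
  classical
  conv_lhs => rw [(chowForm 𝔭 (s + 1)).as_sum, map_sum, coeff_sum]
  refine (totalDegree_finsetSum_le fun γ hγ => ?_)
  rw [lastBlock_monomial, coeff_C_mul]
  refine (totalDegree_mul _ _).trans ?_
  have h1 : (C (coeff γ (chowForm 𝔭 (s + 1))) * firstMono (m := m) s γ).totalDegree ≤ s * ideg 𝔭 (s + 1) := by
    refine (totalDegree_mul _ _).trans ?_
    rw [totalDegree_C, zero_add]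
    refine (totalDegree_firstMono_le s γ).trans ?_
    have : ∀ i : Fin s, bdeg (Fin.castSucc i) γ = ideg 𝔭 (s + 1) := fun i =>
      bdeg_eq_ideg_of_mem_support_chowForm 𝔭 (Nat.succ_pos s) hγ _
    rw [Finset.sum_congr rfl fun i _ => this i]
    simp
  have hmono : (∏ k : Fin (m + 1), (X k : MvPolynomial (Fin (m + 1)) (RU s m)) ^ γ (Fin.last s, k)) =
      monomial (Finsupp.equivFunOnFinite.symm fun k => γ (Fin.last s, k)) 1 := by
    rw [monomial_eq, C_1, one_mul, Finsupp.prod_fintype _ _ (fun k => by simp)]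
    rfl
  have h2 : (coeff e (∏ k : Fin (m + 1), (X k : MvPolynomial (Fin (m + 1)) (RU s m)) ^
      γ (Fin.last s, k))).totalDegree = 0 := by
    rw [hmono, coeff_monomial]
    by_cases hfe : (Finsupp.equivFunOnFinite.symm fun k => γ (Fin.last s, k)) = e
    · rw [if_pos hfe, totalDegree_one]
    · rw [if_neg hfe, totalDegree_zero]
  rw [h2, add_zero]
  exact h1

namespace GSec

variable (𝒢 : GSec m)

/-- Short-cut instance: pin the `ℤ`-algebra structure of `Ω` to the generic one (the one under which
the generic splitting lemmas over an arbitrary field were elaborated). [folklore] -/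
instance (priority := 10000) intAlgebraOm : Algebra ℤ 𝒢.Om := Ring.toIntAlgebra _

/-! ### The norm form in the valuation rings of `Ω` -/

/-- The `D = deg 𝔭` conjugate embeddings `σ : 𝕃₀ → Ω`, indexed by `Fin D`. [folklore] -/
def embEquiv : Fin (ideg 𝒢.𝔭 (𝒢.s + 1)) ≃ (𝒢.L0 →ₐ[𝒢.Kp] 𝒢.Om) :=
  (Fintype.equivFinOfCardEq 𝒢.card_embeddings_eq_ideg).symm

/-- The generic splitting indexed by `Fin D`. [folklore] -/
theorem gOm_eq_C_mul_prod :
    𝒢.gOm = C 𝒢.aOm * ∏ i : Fin (ideg 𝒢.𝔭 (𝒢.s + 1)),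
      (∑ k, C (𝒢.embPt (𝒢.embEquiv i) k) * X k) := by
  rw [gOm_eq_C_mul_Nprod, Nprod, ← Fintype.prod_equiv 𝒢.embEquiv
    (fun i => ∑ k, C (𝒢.embPt (𝒢.embEquiv i) k) * X k)
    (fun σ => ∑ k, C (𝒢.embPt σ k) * X k) (fun i => rfl)]

/-- The coefficients of `g` are the images of the coefficients of `F(u₁, …, u_s; w)`. [folklore] -/
theorem coeff_gOm (e : Fin (m + 1) →₀ ℕ) :
    coeff e 𝒢.gOm = algebraMap (RU 𝒢.s m) 𝒢.Om (coeff e (lastBlock 𝒢.s (chowForm 𝒢.𝔭 (𝒢.s + 1)))) := by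
  rw [gOm, coeff_map]

set_option maxHeartbeats 800000 in
set_option synthInstance.maxHeartbeats 200000 in
/-- **Gauss's lemma for the norm form.** Let `V` be a valuation ring of `Ω` containing the rationals,
and `c₀ ∈ K'`, `c₀ ≠ 0`, such that `c₀ ·` (every coefficient of `g = F(u₁, …, u_s; w)`) lies in `V`.
Then `c₀^q G_Q ∈ V` for every form `Q` of degree `q` (`G_Q = a^q ∏_σ Q(β_σ)`, and
`c₀ a ∏_σ (β_σ · w)` has its coefficients in `V`: `splitNorm_mem_valuationSubring`).
[cite: NesterenkoPhilippon2001, Ch. 3 Prop. 4.11 (pp. 40–41)] -/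
theorem algebraMap_normForm_mem (V : ValuationSubring 𝒢.Om) {c₀ : 𝒢.Kp} (hc₀ : c₀ ≠ 0)
    (hcoeff : ∀ e, algebraMap 𝒢.Kp 𝒢.Om c₀ * coeff e 𝒢.gOm ∈ V)
    (hrat : ∀ κ : ℚ, algebraMap ℚ 𝒢.Om κ ∈ V)
    {Q : Rx m} {q : ℕ} (hQ : Q.IsHomogeneous q) (hQ0 : Q ≠ 0) :
    algebraMap 𝒢.Kp 𝒢.Om (c₀ ^ q * 𝒢.normForm Q q) ∈ V := by
  obtain ⟨κ, Q₀, hκ, hQκ, hQ₀⟩ := exists_int_model hQ hQ0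
  set c : 𝒢.Om := algebraMap 𝒢.Kp 𝒢.Om c₀ * 𝒢.aOm with hc_def
  have hc : c ≠ 0 :=
    mul_ne_zero ((map_ne_zero_iff _ (algebraMap 𝒢.Kp 𝒢.Om).injective).mpr hc₀) 𝒢.aOm_ne_zero
  have hΦ : C (algebraMap 𝒢.Kp 𝒢.Om c₀) * 𝒢.gOm =
      C c * ∏ i : Fin (ideg 𝒢.𝔭 (𝒢.s + 1)), (∑ k, C (𝒢.embPt (𝒢.embEquiv i) k) * X k) := by
    rw [gOm_eq_C_mul_prod, ← mul_assoc, ← C_mul]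
  have hcoeff' : ∀ e, coeff e (C (algebraMap 𝒢.Kp 𝒢.Om c₀) * 𝒢.gOm) ∈ V := fun e => by
    rw [coeff_C_mul]; exact hcoeff e
  have hmem := splitNorm_mem_valuationSubring V hc (fun i => 𝒢.embPt_ne_zero _) hΦ hcoeff' hQ₀
  -- identify the split norm with `c₀^q G_Q` up to the rational unit `κ^D`
  have haeval : ∀ σ : 𝒢.L0 →ₐ[𝒢.Kp] 𝒢.Om,
      aeval (𝒢.embPt σ) Q = algebraMap ℚ 𝒢.Om κ * aeval (𝒢.embPt σ) Q₀ := fun σ => by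
    rw [hQκ, map_mul, aeval_C, show Int.castRingHom ℚ = algebraMap ℤ ℚ from rfl,
      aeval_map_algebraMap]
  have key : algebraMap 𝒢.Kp 𝒢.Om (c₀ ^ q * 𝒢.normForm Q q) =
      algebraMap ℚ 𝒢.Om κ ^ (ideg 𝒢.𝔭 (𝒢.s + 1)) *
        splitNorm q Q₀ c (fun i => 𝒢.embPt (𝒢.embEquiv i)) := by
    rw [map_mul, map_pow, algebraMap_normForm, splitNorm_def, hc_def, mul_pow]
    simp_rw [haeval]
    rw [Finset.prod_mul_distrib, Finset.prod_const, Finset.card_univ, card_embeddings_eq_ideg,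
      ← Fintype.prod_equiv 𝒢.embEquiv (fun i => aeval (𝒢.embPt (𝒢.embEquiv i)) Q₀)
        (fun σ => aeval (𝒢.embPt σ) Q₀) (fun i => rfl)]
    ring
  rw [key]
  exact V.toSubring.mul_mem (V.toSubring.pow_mem (hrat κ) _) hmem

/-! ### The norm form is a polynomial -/

set_option synthInstance.maxHeartbeats 200000 in
/-- **The norm form `G_Q = a^q N_{𝕃₀/K'}(Q(ρ))` of a form `Q ≠ 0` of degree `q` is a polynomial
in `A = ℚ[U']`** (valuative descent: `G_Q` lies in every valuation ring of `Ω` containing `A`, and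
`A` is integrally closed). [cite: NesterenkoPhilippon2001, Ch. 3 Prop. 4.11 (pp. 40–41)] -/
theorem exists_normForm_poly {Q : Rx m} {q : ℕ} (hQ : Q.IsHomogeneous q) (hQ0 : Q ≠ 0) :
    ∃ N : RU 𝒢.s m, algebraMap (RU 𝒢.s m) 𝒢.Kp N = 𝒢.normForm Q q := by
  have h := mem_range_of_forall_valuationSubring (B := RU 𝒢.s m) (K := 𝒢.Kp) (Ω := 𝒢.Om)
    (𝒢.normForm Q q) fun V hV => by
      have := 𝒢.algebraMap_normForm_mem V one_ne_zero (fun e => ?_) (fun κ => ?_) hQ hQ0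
      · rwa [one_pow, one_mul] at this
      · rw [map_one, one_mul, coeff_gOm]; exact hV _
      · rw [IsScalarTower.algebraMap_apply ℚ (RU 𝒢.s m) 𝒢.Om]; exact hV _
  obtain ⟨N, hN⟩ := h
  exact ⟨N, hN⟩

/-- **The norm form as a polynomial**: `normFormPoly Q q ∈ A` with `algebraMap (normFormPoly Q q) =
normForm Q q` (for a form `Q ≠ 0` of degree `q`; `0` otherwise). [folklore] -/
def normFormPoly (Q : Rx m) (q : ℕ) : RU 𝒢.s m := by
  classical
  exact if h : Q.IsHomogeneous q ∧ Q ≠ 0 then (𝒢.exists_normForm_poly h.1 h.2).choose else 0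

/-- The defining property of `normFormPoly`. [folklore] -/
theorem algebraMap_normFormPoly {Q : Rx m} {q : ℕ} (hQ : Q.IsHomogeneous q) (hQ0 : Q ≠ 0) :
    algebraMap (RU 𝒢.s m) 𝒢.Kp (𝒢.normFormPoly Q q) = 𝒢.normForm Q q := by
  classical
  rw [normFormPoly, dif_pos ⟨hQ, hQ0⟩]
  exact (𝒢.exists_normForm_poly hQ hQ0).choose_spec

/-- The norm form polynomial of a form outside `𝔭` is non-zero. [folklore] -/
theorem normFormPoly_ne_zero {Q : Rx m} {q : ℕ} (hQ : Q.IsHomogeneous q) (hQp : Q ∉ 𝒢.𝔭) :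
    𝒢.normFormPoly Q q ≠ 0 := fun h => by
  have hQ0 : Q ≠ 0 := fun h0 => hQp (h0 ▸ 𝒢.𝔭.zero_mem)
  have := 𝒢.algebraMap_normFormPoly hQ hQ0
  rw [h, map_zero] at this
  exact 𝒢.normForm_ne_zero hQ hQp q this.symm

/-! ### Its degree -/

/-- The ring at infinity `W ⊂ K'` of the degree valuation. [folklore] -/
abbrev Winf : ValuationSubring 𝒢.Kp := degSubring (σ := Fin 𝒢.s × Fin (m + 1)) (K := ℚ) (F := 𝒢.Kp)

/-- Short-cut instance: `Ω` as an algebra over the ring at infinity of `K'`. [folklore] -/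
instance algebraWinfOm : Algebra 𝒢.Winf 𝒢.Om :=
  ((algebraMap 𝒢.Kp 𝒢.Om).comp (algebraMap 𝒢.Winf 𝒢.Kp)).toAlgebra

/-- Short-cut instance. [folklore] -/
instance smulWinfOm : SMul 𝒢.Winf 𝒢.Om := Algebra.toSMul

/-- Short-cut instance: the tower `W → K' → Ω`. [folklore] -/
instance towerWinf : IsScalarTower 𝒢.Winf 𝒢.Kp 𝒢.Om :=
  IsScalarTower.of_algebraMap_eq fun _ => rfl

set_option synthInstance.maxHeartbeats 200000 in
/-- **The norm form polynomial has total degree `≤ s · deg 𝔭 · q`** (the degree valuation ring at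
infinity of `K'`, `u^{−sD}`-rescaled Gauss lemma in `Ω`, valuative descent).
[cite: NesterenkoPhilippon2001, Ch. 10 Lemma 3.1 (p. 153), via [Nes3] (19)] -/
theorem totalDegree_normFormPoly_le (w₀ : Fin 𝒢.s × Fin (m + 1)) {Q : Rx m} {q : ℕ}
    (hQ : Q.IsHomogeneous q) (hQ0 : Q ≠ 0) :
    (𝒢.normFormPoly Q q).totalDegree ≤ 𝒢.s * ideg 𝒢.𝔭 (𝒢.s + 1) * q := by
  set n := 𝒢.s * ideg 𝒢.𝔭 (𝒢.s + 1) with hn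
  set t : 𝒢.Kp := (algebraMap (RU 𝒢.s m) 𝒢.Kp (X w₀))⁻¹ with ht
  have ht0 : t ≠ 0 := inv_ne_zero ((map_ne_zero_iff _ (IsFractionRing.injective _ _)).mpr (X_ne_zero w₀))
  have hc₀ : t ^ n ≠ 0 := pow_ne_zero _ ht0
  -- `t^{nq} G_Q ∈ W` by valuative descent from `Ω`
  have hmem : (t ^ n) ^ q * 𝒢.normForm Q q ∈ (algebraMap 𝒢.Winf 𝒢.Kp).range := by
    refine mem_range_of_forall_valuationSubring (B := 𝒢.Winf) (K := 𝒢.Kp) (Ω := 𝒢.Om) _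
      fun V hV => ?_
    refine 𝒢.algebraMap_normForm_mem V hc₀ (fun e => ?_) (fun κ => ?_) hQ hQ0
    · rw [coeff_gOm, IsScalarTower.algebraMap_apply (RU 𝒢.s m) 𝒢.Kp 𝒢.Om, ← map_mul]
      have hm : t ^ n * algebraMap (RU 𝒢.s m) 𝒢.Kp
          (coeff e (lastBlock 𝒢.s (chowForm 𝒢.𝔭 (𝒢.s + 1)))) ∈ 𝒢.Winf := by
        rw [ht]
        exact inv_pow_mul_mem_degSubring w₀ (totalDegree_coeff_lastBlock_chowForm_le 𝒢.𝔭 𝒢.s e)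
      exact hV ⟨_, hm⟩
    · have hm : algebraMap ℚ 𝒢.Kp κ ∈ 𝒢.Winf := by
        rw [IsScalarTower.algebraMap_apply ℚ (RU 𝒢.s m) 𝒢.Kp, MvPolynomial.algebraMap_eq]
        exact algebraMap_C_mem_degSubring κ
      rw [IsScalarTower.algebraMap_apply ℚ 𝒢.Kp 𝒢.Om]
      exact hV ⟨_, hm⟩
  obtain ⟨b, hb⟩ := hmem
  have hbW : (t ^ n) ^ q * 𝒢.normForm Q q ∈ 𝒢.Winf := by rw [← hb]; exact b.2
  rw [← 𝒢.algebraMap_normFormPoly hQ hQ0, ← pow_mul, ht] at hbW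
  exact totalDegree_le_of_mem_degSubring w₀ hbW

end GSec

end Nesterenko

end Literature.NumberTheory.Transcendental
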